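import Literature.AlgebraicGeometry.Frobenioids.ProfiniteUnitsTopologyUniqueBridge
import Literature.GroupTheory.ProPStronglyComplete
import HarnessLib

/-!
# Frobenioids I, Def. 2.8 (i) "[uniquely determined]" beyond the abelian case, II: pro-`p` groups (Serre's theorem)

Mochizuki, *The geometry of Frobenioids I*, Kyushu J. Math. **62** (2008), Definition 2.8 (i), kurims p. 52
[cite: MochizukiFrdI2008, Def. 2.8(i) p.52], bracket "[uniquely determined]" = the tree's named statement
`TfgProfiniteTopologyUnique M` (any two topologically finitely generated profinite group topologies on the group `M`
coincide; abelian case `TfgProfiniteTopologyUnique.of_commGroup`; general case = Nikolov–Segal).  This PROOF-ONLY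
file (no definitions) adds the NEW INSTANCE FAMILY

* `TfgProfiniteTopologyUnique.of_proP` — every group admitting a topologically finitely generated PRO-`p` profinite
  group topology: in that topology every finite-index subgroup is open by Serre's theorem (tree
  `Literature.GroupTheory.isOpen_of_finiteIndex_of_proP`, `ProPStronglyComplete.lean`,
  [cite: DixonDuSautoyMannSegal1999, Ch. 1 Thm. 1.17]), so the bridge
  `TfgProfiniteTopologyUnique.of_forall_finiteIndex_isOpen` (`ProfiniteUnitsTopologyUniqueBridge.lean`) applies;
* `TfgProfiniteTopologyUnique.of_isOpen_proP` — more generally every group admitting a topologically finitely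
  generated profinite group topology with an OPEN pro-`p` subgroup (virtually pro-`p`: e.g. compact `p`-adic analytic
  groups);
* `IsTfgProfinite.eq_of_proP` — the two-topology form: a topologically finitely generated pro-`p` profinite group
  topology on a group equals every topologically finitely generated profinite group topology on it.

Cell abc-iut, FACT-LIST row F-1275 (`TfgProfiniteTopologyUnique`, [FrdI] Def. 2.8 (i) p.52): instance form PROVED for
all topologically finitely generated pro-`p` groups (e.g. free pro-`p` groups of finite rank, `p`-adic analytic
pro-`p` groups), beyond the abelian witness.  HONEST FRAMING: refereed pre-IUT group theory; nothing here bears on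
[IUTchIII] Cor. 3.12.
-/

namespace Literature.AlgebraicGeometry.Frobenioids

open _root_.Topology Filter

universe u

/-- **Def. 2.8 (i) "[uniquely determined]" for PRO-`p` groups (new instance family, via Serre's theorem).**
If the group `M` admits a topologically finitely generated profinite group topology which is pro-`p` (every
continuous finite quotient `M ⧸ U`, `U` open normal, is a `p`-group), then any two topologically finitely
generated profinite group topologies on `M` coincide — because in the pro-`p` one every finite-index subgroup is
open (`Literature.GroupTheory.isOpen_of_finiteIndex_of_proP`).
[cite: MochizukiFrdI2008, Def. 2.8(i) p.52] [cite: DixonDuSautoyMannSegal1999, Ch. 1 Thm. 1.17] -/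
theorem TfgProfiniteTopologyUnique.of_proP (M : Type u) [Group M] [t₀ : TopologicalSpace M]
    (h₀ : IsTfgProfinite M) {p : ℕ} [Fact p.Prime]
    (hP : ∀ U : OpenNormalSubgroup M, IsPGroup p (M ⧸ (U : Subgroup M))) :
    TfgProfiniteTopologyUnique M := by
  haveI := h₀.isTopologicalGroup
  haveI := h₀.compactSpace
  haveI := h₀.totallyDisconnectedSpace
  refine TfgProfiniteTopologyUnique.of_forall_finiteIndex_isOpen M h₀ ?_
  intro H hH
  exact Literature.GroupTheory.isOpen_of_finiteIndex_of_proP hP h₀.exists_finset_dense H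

/-- **Def. 2.8 (i) "[uniquely determined]" for VIRTUALLY pro-`p` groups (instance family).**  If the group `M`
admits a topologically finitely generated profinite group topology with an OPEN subgroup `K` which, in the subspace
topology, is pro-`p`, then any two topologically finitely generated profinite group topologies on `M` coincide:
`K` is again topologically finitely generated (Schreier, `Literature.GroupTheory.exists_finset_dense_closure_of_isOpen`),
so by Serre's theorem a finite-index subgroup `H` of `M` meets `K` in an open subgroup of `K`, i.e. `H ⊓ K` is open
in `M`, whence `H` is open; now apply the bridge.  (E.g. compact `p`-adic analytic groups such as `GL_n(ℤ_p)`.)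
[cite: MochizukiFrdI2008, Def. 2.8(i) p.52] [cite: DixonDuSautoyMannSegal1999, Ch. 1 Thm. 1.17] -/
theorem TfgProfiniteTopologyUnique.of_isOpen_proP (M : Type u) [Group M] [t₀ : TopologicalSpace M]
    (h₀ : IsTfgProfinite M) {p : ℕ} [Fact p.Prime] (K : Subgroup M) (hKo : IsOpen (K : Set M))
    (hP : ∀ U : OpenNormalSubgroup K, IsPGroup p (K ⧸ (U : Subgroup K))) :
    TfgProfiniteTopologyUnique M := by
  haveI := h₀.isTopologicalGroup
  haveI := h₀.compactSpace
  haveI := h₀.totallyDisconnectedSpace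
  haveI : CompactSpace K := isCompact_iff_compactSpace.mp (K.isClosed_of_isOpen hKo).isCompact
  have hfgK := Literature.GroupTheory.exists_finset_dense_closure_of_isOpen h₀.exists_finset_dense K hKo
  refine TfgProfiniteTopologyUnique.of_forall_finiteIndex_isOpen M h₀ ?_
  intro H hH
  -- `H ⊓ K`, viewed in `K`, has finite index, hence is open in `K` (Serre), hence open in `M`
  have hHK : IsOpen ((H.subgroupOf K : Subgroup K) : Set K) :=
    Literature.GroupTheory.isOpen_of_finiteIndex_of_proP hP hfgK (H.subgroupOf K)
  have hsub : Subtype.val '' ((H.subgroupOf K : Subgroup K) : Set K) = ((H ⊓ K : Subgroup M) : Set M) := by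
    ext x
    simp only [Set.mem_image, SetLike.mem_coe, Subgroup.mem_subgroupOf, Subgroup.mem_inf]
    constructor
    · rintro ⟨y, hy, rfl⟩
      exact ⟨hy, y.2⟩
    · rintro ⟨hxH, hxK⟩
      exact ⟨⟨x, hxK⟩, hxH, rfl⟩
  have hHK' : IsOpen ((H ⊓ K : Subgroup M) : Set M) := hsub ▸ hKo.isOpenMap_subtype_val _ hHK
  exact Subgroup.isOpen_mono inf_le_left hHK'

/-- The two-topology form: a topologically finitely generated PRO-`p` profinite group topology `t₀` on a group
EQUALS every topologically finitely generated profinite group topology `t` on that group.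
[cite: MochizukiFrdI2008, Def. 2.8(i) p.52] [cite: DixonDuSautoyMannSegal1999, Ch. 1 Thm. 1.17] -/
theorem IsTfgProfinite.eq_of_proP {M : Type u} [Group M] {t₀ t : TopologicalSpace M}
    (h₀ : @IsTfgProfinite M _ t₀) {p : ℕ} [Fact p.Prime]
    (hP : ∀ U : @OpenNormalSubgroup M _ t₀, IsPGroup p (M ⧸ (U : Subgroup M)))
    (h : @IsTfgProfinite M _ t) : t = t₀ :=
  (@TfgProfiniteTopologyUnique.of_proP M _ t₀ h₀ p _ hP) t t₀ h h₀

end Literature.AlgebraicGeometry.Frobenioids
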